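/-
HODGE LADDER — STAGE 4, §0-bis of the scoping document (v4): the STRICT sense of "abelian motivic type"
(Arapura 2006: `Y` motivated by `X` ⟹ HC for the powers of `X` gives HC for the powers of `Y`, Lemma 4.2),
kernel-typed on the real carriers modulo named published facts, with the two instances in print that bear on
rows 1, 2a and 2b: Hilbert schemes of points of K3 surfaces (de Cataldo–Migliorini 2002 Thm. 6.2.1 / Arapura
Thm. 7.4) and Beauville's generalized Kummer varieties themselves (Xu 2018 Thm. 1.3 — UNCONDITIONAL).
Sibling of `CorCM/Stage4Interfaces.lean` (at the 400-line limit), `CorCM/Stage4RowOneKugaSatake.lean`,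
`CorCM/Stage4RoadR1AbelianTypePieces.lean`, `CorCM/Stage4RowOneInstances.lean`.  Literature seat
hodge-director-lit-stage4, gen 4; companion document run/shared/lean/pub/hodge-director/STAGE4-ABELIAN-MOTIVIC-TYPE.md
(v4, §0-bis and CHANGES IN v4).  Theorems only; nothing asserted beyond the named facts taken as hypotheses.
-/
import Summits.HodgeConjecture.CorCM.Stage4RowOneKugaSatake
import Summits.HodgeConjecture.CorCM.Stage4RowOneInstances
import Summits.HodgeConjecture.CorCM.Stage4RoadR1AbelianTypePieces
import Literature.AlgebraicGeometry.HodgeTheory.DominatedByPowersHodgeConjecture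
import Literature.AlgebraicGeometry.Hyperkaehler.GeneralizedKummerVarietyHodgeConjecture
import Literature.AlgebraicGeometry.Motives.AbelianVarietyProductDimProofs
import HarnessLib

/-!
# Stage 4, §0-bis: the STRICT "abelian motivic type" road — `HC_AV` ALONE suffices for varieties dominated by powers of an abelian variety (Arapura 2006 Lemma 4.2); Hilbert schemes of K3 surfaces (row 2a proper) and generalized Kummer varieties (row 2b proper)

The scoping document (v1–v3, §0) records André's reduction: the motives of rows 1–3 lie in `M(Ab)` for
MOTIVATED correspondences (André 1996 Thm. 0.6.3 / 7.1 / 7.2, Soldatenkov 2022), whence their Hodge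
classes are motivated, and `HC_AV` alone is on neither printed road to algebraicity ((R1) needs `B`, (R2)
needs an algebraic Kuga–Satake correspondence).  In Arapura's terminology (Adv. Math. 207 (2006), §1) this
is WEAK motivation by an abelian variety, which yields only `AC` ("Hodge ⟹ motivated", Cor. 4.4).  STRONG
motivation — the motive of `Y` lies in the tensor category generated by the motive of `X` through
correspondences modelled on `⟨X⟩`, in particular through ALGEBRAIC correspondences (Lemma 1.1) — transfers
the Hodge conjecture itself: "if the Hodge conjecture holds for `X` and all its powers, then it holds for
any variety motivated by it" (Lemma 4.2).  So a variety strongly motivated by an abelian variety inherits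
the Hodge conjecture from `HC_AV` with NOTHING ELSE.  This file types that road on the real carriers
(`HodgeTheory.IsDominatedByPowers`, Literature `HodgeTheory/DominatedByPowersHodgeConjecture`) and wires the
printed instances:

* §A `hc_of_isDominatedByPowers_abelianVariety` — **`HC_AV` ⟹ HC for every smooth projective `Y`
  dominated by the powers of an abelian variety, and for all powers of `Y`**, modulo ONE named fact
  (Arapura Lemma 4.2 in the algebraic form of Lemma 1.1); `HC_AV` feeds the powers `A^{m+1}` through
  `AbelianVariety.powSucc` and the iso `(A.powSucc m).X ≅ A.X.pow (m + 1)` (proved here).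
* §B row 2a PROPER (the Hilbert schemes `S^{[n]}` of projective K3 surfaces themselves, not the whole
  deformation class `IsOfK3HilbertType`): `hc_K3HilbertScheme_of_hc_K3Powers` — **`HC_K3Powers` ⟹ HC for
  `S^{[n]}` and all its powers** (dCM 2002 Thm. 6.2.1 + Arapura Lemma 4.2; the inference Arapura prints as
  Cor. 7.6 for abelian surfaces); hence road (R2) `KSH_K3_Betti → HC_AV → …` (with Floccari 2026 Thm. 3.5,
  file `Stage4RowOneKugaSatake`), road (R1) `B ∀ → …` (with the André record, file
  `Stage4RoadR1AbelianTypePieces`), the per-surface form, and the UNCONDITIONAL instance for K3 surfaces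
  with `T(S)_ℚ ↪ U³ ⊕ ⟨-m⟩` (Floccari 2026 Thm. 5.11 (ii), file `Stage4RowOneInstances`).
* §C row 2b PROPER (Beauville's `Kⁿ(A)` of abelian surfaces themselves): `hc_generalizedKummerVariety`,
  `hc_generalizedKummerVariety_pow` — **HC for `Kⁿ(A)`, every `n ≥ 1`, and all its powers, UNCONDITIONALLY**
  modulo the CITE record of Xu 2018 Thm. 1.3 (the deformation class `HC_KummerType` stays OPEN for `n ≥ 4`
  outside `A₂•`); `hc_kummerSurface_pow` — HC for all powers of Kummer surfaces (row 1 instance); `hc_hilbertScheme_kummerSurface`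
  — HC for `Km(A)^{[n]}` and its powers, unconditional modulo three CITE records;
  `isOfGeneralizedKummerType_and_hc` — every `Kⁿ(A)` carrying a Hodge model is a member of
  the `Kumⁿ` deformation class at which `HodgeConjectureFor (2 * n)` holds (an ANCHOR for `HC_KummerType`).

Sources: Arapura 2006 Lemma 1.1 / 4.2 / Cor. 4.4 / Thm. 7.4 / Cor. 7.6; de Cataldo–Migliorini 2002 Thm. 6.2.1,
Rem. 6.2.3; Xu 2018 Thm. 1.3, Lemma 3.2; Floccari 2026 Thm. 3.5, 5.11; read verbatim by the seat (arXiv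
texts), see the Literature files' module docstrings.
-/

noncomputable section

open CategoryTheory MonoidalCategory
open Literature.AlgebraicGeometry
open Literature.AlgebraicGeometry.Motives (SchemeOver IsSmoothProjective AbelianVariety)
open Literature.AlgebraicGeometry.HodgeTheory
open Literature.AlgebraicGeometry.HilbertScheme (IsHilbertSchemeOfPoints)
open Literature.AlgebraicGeometry.Surfaces (IsK3Surface Floccari2026_hodgeClasses_algebraic_K3Powers_iff_kugaSatakePowers)
open Literature.AlgebraicGeometry.Hyperkaehler (IsGeneralizedKummerVarietyOf IsOfGeneralizedKummerType
  Xu2018_hodgeClasses_algebraic_generalizedKummerVariety)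
open Literature.AlgebraicGeometry.Andre1996 (Andre1996_hodgeClasses_motivated_of_isAbelianTypePiece)

namespace Summit.HodgeConjecture.CorCM.Stage4

/-! ## §A The strict road: dominated by powers of an abelian variety ⟹ HC from `HC_AV` alone -/

/-- The underlying scheme of the abelian-variety power `A^{m+1}` (`AbelianVariety.powSucc`, bracketed
`((A × A) × A) ⋯`) is isomorphic to the cartesian power `A.X.pow (m + 1)` (`Motives.SchemeOver.pow`, bracketed
`((Spec ℂ ⊗ A) ⊗ A) ⋯`): the left unitor on the innermost factor, whiskered. [folklore] -/
def powSuccXIso (A : AbelianVariety ℂ) : (m : ℕ) → (A.powSucc m).X ≅ A.X.pow (m + 1)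
  | 0 => (λ_ A.X).symm
  | m + 1 => whiskerRightIso (powSuccXIso A m) A.X

/-- `dim A^{m+1} = (m + 1) · dim A` (from `AbelianVariety.dim_prod`). [folklore] -/
theorem dim_powSucc' (A : AbelianVariety ℂ) : ∀ m : ℕ, (A.powSucc m).dim = (m + 1) * A.dim
  | 0 => by simp
  | m + 1 => by
    rw [AbelianVariety.powSucc_succ, AbelianVariety.dim_prod, dim_powSucc' A m]
    ring

/-- `HC_AV` gives the Hodge conjecture for every positive cartesian power `A.X.pow (m + 1)` of the underlying
variety of a complex abelian variety (transport along `powSuccXIso`). [folklore] -/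
theorem hc_pow_abelianVariety_of_hc_av (hAV : HC_AV) (A : AbelianVariety ℂ) (m : ℕ) :
    HodgeConjectureFor ((m + 1) * A.dim) (A.X.pow (m + 1)) := by
  have h := hc_av_iff.mp hAV (A.powSucc m)
  rw [dim_powSucc'] at h
  exact (hodgeConjectureFor_iff_of_iso' (powSuccXIso A m)).1 h

/-- **The STRICT road (Arapura 2006, Lemma 4.2 with Lemma 1.1): `HC_AV` ALONE gives the Hodge conjecture for
every smooth projective complex variety `Y` whose cohomology is dominated by algebraic correspondences from
the powers of a complex abelian variety `A` — and for all powers of `Y`**, modulo the single record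
`Arapura2006_hodgeClasses_algebraic_of_isDominatedByPowers`.  No standard conjecture, no Kuga–Satake input.
(Abelian varieties are smooth projective: the tree's PROVED `AbelianVariety.isSmoothProjective_holds`.)
[cite: Arapura2006, Lemma 4.2 and Lemma 1.1] -/
theorem hc_of_isDominatedByPowers_abelianVariety (h42 : Arapura2006_hodgeClasses_algebraic_of_isDominatedByPowers)
    (hAV : HC_AV) (A : AbelianVariety ℂ) {dY : ℕ} {Y : SchemeOver ℂ} (hY : IsSmoothProjective dY Y)
    (hdom : IsDominatedByPowers dY Y A.dim A.X) :
    HodgeConjectureFor dY Y ∧ ∀ m : ℕ, HodgeConjectureFor ((m + 1) * dY) (Y.pow (m + 1)) :=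
  h42 AbelianVariety.isSmoothProjective_holds hY hdom (hc_pow_abelianVariety_of_hc_av hAV A)

/-! ## §B Row 2a proper: Hilbert schemes of points of projective K3 surfaces -/

section HilbertSchemes

variable {S H : SchemeOver ℂ} {n : ℕ} {Ξ : (S ⊗ H).left.IdealSheafData}

/-- **`HC_K3Powers` ⟹ the Hodge conjecture for the Hilbert scheme `S^{[n]}` of every projective K3 surface `S`
and for all its powers** (de Cataldo–Migliorini 2002 Thm. 6.2.1: `S^{[n]}` is dominated by the powers of `S`;
Arapura 2006 Lemma 4.2), modulo the two records.  Row 2a of the scoping document for the Hilbert schemes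
THEMSELVES thus reduces to row 1. [cite: DecataldoMigliorini2002, Thm. 6.2.1] [cite: Arapura2006, Lemma 4.2 and Thm. 7.4] -/
theorem hc_K3HilbertScheme_of_hc_K3Powers (h42 : Arapura2006_hodgeClasses_algebraic_of_isDominatedByPowers)
    (h74 : DecataldoMigliorini2002_hilbertScheme_isDominatedByPowers) (h : HC_K3Powers) (hS : IsK3Surface S)
    (hH : IsHilbertSchemeOfPoints n S H Ξ) (hHs : IsSmoothProjective (2 * n) H) :
    HodgeConjectureFor (2 * n) H ∧ ∀ m : ℕ, HodgeConjectureFor ((m + 1) * (2 * n)) (H.pow (m + 1)) :=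
  Arapura2006_hodgeClasses_algebraic_of_isDominatedByPowers.hodgeConjectureFor_hilbertScheme_of_forall_pow
    h42 h74 hS.isSmoothProjective hH hHs (h hS)

/-- Per-surface form: the Hodge conjecture for all powers of ONE projective K3 surface `S` gives it for `S^{[n]}`
and its powers. [cite: Arapura2006, Lemma 4.2 and Thm. 7.4] -/
theorem hc_K3HilbertScheme_of_forall_pow (h42 : Arapura2006_hodgeClasses_algebraic_of_isDominatedByPowers)
    (h74 : DecataldoMigliorini2002_hilbertScheme_isDominatedByPowers) (hS : IsK3Surface S)
    (hpow : ∀ m : ℕ, HodgeConjectureFor (m * 2) (S.pow m)) (hH : IsHilbertSchemeOfPoints n S H Ξ)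
    (hHs : IsSmoothProjective (2 * n) H) :
    HodgeConjectureFor (2 * n) H ∧ ∀ m : ℕ, HodgeConjectureFor ((m + 1) * (2 * n)) (H.pow (m + 1)) :=
  Arapura2006_hodgeClasses_algebraic_of_isDominatedByPowers.hodgeConjectureFor_hilbertScheme_of_forall_pow
    h42 h74 hS.isSmoothProjective hH hHs hpow

/-- **Road (R2) for row 2a proper: `KSH_K3_Betti → HC_AV →` HC for all Hilbert schemes `S^{[n]}` of projective
K3 surfaces and their powers**, modulo three records (Floccari 2026 Thm. 3.5; Arapura 2006 Lemma 4.2; dCM 2002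
Thm. 6.2.1) — the composition of `hc_K3Powers_of_KSH_betti_of_floccari` (file `Stage4RowOneKugaSatake`) with
§B. [cite: Floccari2026, Thm. 3.5] [cite: Arapura2006, Lemma 4.2] [cite: DecataldoMigliorini2002, Thm. 6.2.1] -/
theorem hc_K3HilbertScheme_of_KSH_betti (h35 : Floccari2026_hodgeClasses_algebraic_K3Powers_iff_kugaSatakePowers)
    (h42 : Arapura2006_hodgeClasses_algebraic_of_isDominatedByPowers)
    (h74 : DecataldoMigliorini2002_hilbertScheme_isDominatedByPowers) (hKS : KSH_K3_Betti) (hAV : HC_AV)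
    (hS : IsK3Surface S) (hH : IsHilbertSchemeOfPoints n S H Ξ) (hHs : IsSmoothProjective (2 * n) H) :
    HodgeConjectureFor (2 * n) H ∧ ∀ m : ℕ, HodgeConjectureFor ((m + 1) * (2 * n)) (H.pow (m + 1)) :=
  hc_K3HilbertScheme_of_hc_K3Powers h42 h74 (hc_K3Powers_of_KSH_betti_of_floccari h35 hKS hAV) hS hH hHs

/-- Per-surface form of road (R2): `HC_AV` and an algebraic Kuga–Satake correspondence for ONE projective K3
surface `S` give the Hodge conjecture for `S^{[n]}` and its powers. [cite: Floccari2026, Thm. 3.5]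
[cite: Arapura2006, Lemma 4.2] -/
theorem hc_K3HilbertScheme_at_of_ksCorrespondenceAlgebraic
    (h35 : Floccari2026_hodgeClasses_algebraic_K3Powers_iff_kugaSatakePowers)
    (h42 : Arapura2006_hodgeClasses_algebraic_of_isDominatedByPowers)
    (h74 : DecataldoMigliorini2002_hilbertScheme_isDominatedByPowers) (hAV : HC_AV) (hS : IsK3Surface S)
    (hKS : IsKSCorrespondenceAlgebraicBetti hS.isSmoothProjective) (hH : IsHilbertSchemeOfPoints n S H Ξ)
    (hHs : IsSmoothProjective (2 * n) H) :
    HodgeConjectureFor (2 * n) H ∧ ∀ m : ℕ, HodgeConjectureFor ((m + 1) * (2 * n)) (H.pow (m + 1)) :=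
  hc_K3HilbertScheme_of_forall_pow h42 h74 hS (hc_K3Powers_at_of_ksCorrespondenceAlgebraic h35 hAV hS hKS) hH hHs

/-- **Road (R1) for row 2a proper WITH POWERS: `B` for all smooth projective complex varieties ⟹ HC for every
`S^{[n]}` and all its powers** (André's abelian-type pieces give `HC_K3Powers`, file
`Stage4RoadR1AbelianTypePieces`; then §B).  Unlike `hc_K3HilbertType_of_B_of_soldatenkov` (Stage4Interfaces v2,
single varieties of the whole deformation class), this reaches the powers of `S^{[n]}`; `HC_AV` is not an input.
[cite: Andre1996Motifs, Thm. 0.6.3 and §6.3] [cite: Arapura2006, Lemma 4.2] -/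
theorem hc_K3HilbertScheme_of_B_of_andre (hA : Andre1996_hodgeClasses_motivated_of_isAbelianTypePiece)
    (hB : ∀ (d : ℕ) (Z : SchemeOver ℂ) (η : complexBetti Z 2), IsSmoothProjective d Z → StandardConjectureBStar d Z η)
    (h42 : Arapura2006_hodgeClasses_algebraic_of_isDominatedByPowers)
    (h74 : DecataldoMigliorini2002_hilbertScheme_isDominatedByPowers) (hS : IsK3Surface S)
    (hH : IsHilbertSchemeOfPoints n S H Ξ) (hHs : IsSmoothProjective (2 * n) H) :
    HodgeConjectureFor (2 * n) H ∧ ∀ m : ℕ, HodgeConjectureFor ((m + 1) * (2 * n)) (H.pow (m + 1)) :=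
  hc_K3HilbertScheme_of_hc_K3Powers h42 h74 (hc_K3Powers_of_B_of_andre hA hB) hS hH hHs

/-- **UNCONDITIONAL printed instance for row 2a proper**: for a projective K3 surface `S` whose rational
transcendental lattice embeds isometrically into `(U^{⊕3} ⊕ ⟨-m⟩) ⊗ ℚ` (read in a marking, the clauses of
`Stage4RowOneInstances.forall_hc_pow_of_transcendental_embedding`; Floccari 2026 Thm. 5.11 (ii): HC for all powers
of `S`), the Hodge conjecture holds for `S^{[n]}` and all its powers — modulo three CITE records of printed
theorems, no open hypothesis. [cite: Floccari2026, Thm. 5.11 (ii)] [cite: Arapura2006, Lemma 4.2]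
[cite: DecataldoMigliorini2002, Thm. 6.2.1] -/
theorem hc_K3HilbertScheme_of_transcendental_embedding
    (hF : Surfaces.Floccari2026_hodgeClasses_algebraic_powers_of_K3_of_transcendental_embedding)
    (h42 : Arapura2006_hodgeClasses_algebraic_of_isDominatedByPowers)
    (h74 : DecataldoMigliorini2002_hilbertScheme_isDominatedByPowers) (hS : IsK3Surface S)
    (η : complexBetti S (2 * 1) ≃ₗ[ℂ] (Surfaces.K3Index → ℂ)) (p : complexBetti S (2 * 2))
    (hp : p ≠ 0) (hpi : IsIntegralClass p)
    (hgen : ∀ q : complexBetti S (2 * 2), IsIntegralClass q → ∃ k : ℤ, q = k • p)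
    (hint : ∀ c : complexBetti S (2 * 1), IsIntegralClass c ↔ ∃ v : Surfaces.K3Index → ℤ, η c = fun i => (v i : ℂ))
    (hcup : ∀ a b : complexBetti S (2 * 1),
      Literature.AlgebraicTopology.SingularHomology.cupProduct (rfl : 2 * 1 + 2 * 1 = 2 * 2) a b =
        Surfaces.k3Form (η a) (η b) • p)
    {m : ℕ} (hm : 0 < m) (ι : (Surfaces.K3Index → ℚ) →ₗ[ℚ] (Surfaces.U3mIndex → ℚ))
    (hiso : ∀ v w : Surfaces.K3Index → ℚ, Surfaces.IsTranscendentalCoord S η v →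
      Surfaces.IsTranscendentalCoord S η w → Surfaces.u3mFormQ m (ι v) (ι w) = Surfaces.k3FormRat v w)
    (hinj : ∀ v : Surfaces.K3Index → ℚ, Surfaces.IsTranscendentalCoord S η v → ι v = 0 → v = 0)
    (hH : IsHilbertSchemeOfPoints n S H Ξ) (hHs : IsSmoothProjective (2 * n) H) :
    HodgeConjectureFor (2 * n) H ∧ ∀ k : ℕ, HodgeConjectureFor ((k + 1) * (2 * n)) (H.pow (k + 1)) :=
  hc_K3HilbertScheme_of_forall_pow h42 h74 hS
    (forall_hc_pow_of_transcendental_embedding hF hS η p hp hpi hgen hint hcup hm ι hiso hinj) hH hHs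

end HilbertSchemes

/-! ## §C Row 2b proper: Beauville's generalized Kummer varieties `Kⁿ(A)` themselves (Xu 2018 Thm. 1.3, unconditional) -/

section GeneralizedKummer

variable {n : ℕ} {A : AbelianVariety ℂ} {K : SchemeOver ℂ}

/-- **The Hodge conjecture for the generalized Kummer variety `Kⁿ(A)` of a complex abelian surface, every
`n ≥ 1` — UNCONDITIONAL in print (Xu 2018 Thm. 1.3: `Kⁿ(A)` is motivated by `A`, HC for products of abelian
surfaces; no `HC_AV`, no `B`, no Kuga–Satake input)**, CITE wiring of the record.  Contrast: for the
deformation class (`HC_KummerType`, Stage4Interfaces v2) only `n = 2, 3` and the `A₂•`-classes are in print.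
[cite: Xu2018Kummer, Thm. 1.3] -/
theorem hc_generalizedKummerVariety (hXu : Xu2018_hodgeClasses_algebraic_generalizedKummerVariety) (hA : A.dim = 2)
    (hn : 1 ≤ n) (hK : IsGeneralizedKummerVarietyOf n A K) (hKs : IsSmoothProjective (2 * n) K) :
    HodgeConjectureFor (2 * n) K :=
  Xu2018_hodgeClasses_algebraic_generalizedKummerVariety.hodgeConjectureFor hXu hA hn hK hKs

/-- Same, for all cartesian powers `Kⁿ(A)^{m+1}` (equal factors in Xu's Thm. 1.3). [cite: Xu2018Kummer, Thm. 1.3] -/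
theorem hc_generalizedKummerVariety_pow (hXu : Xu2018_hodgeClasses_algebraic_generalizedKummerVariety)
    (hA : A.dim = 2) (hn : 1 ≤ n) (hK : IsGeneralizedKummerVarietyOf n A K) (hKs : IsSmoothProjective (2 * n) K)
    (m : ℕ) : HodgeConjectureFor ((m + 1) * (2 * n)) (K.pow (m + 1)) :=
  Xu2018_hodgeClasses_algebraic_generalizedKummerVariety.hodgeConjectureFor_pow hXu hA hn hK hKs m

/-- **Row 1 instance — all powers of Kummer surfaces**: for the Kummer surface `Km(A) = K¹(A)` of a complex
abelian surface (a projective K3 surface), the Hodge conjecture holds for every cartesian power `Km(A)^{m+1}`,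
unconditionally in print. [cite: Xu2018Kummer, Thm. 1.3 and §1] -/
theorem hc_kummerSurface_pow (hXu : Xu2018_hodgeClasses_algebraic_generalizedKummerVariety) (hA : A.dim = 2)
    (hK : IsGeneralizedKummerVarietyOf 1 A K) (hKs : IsSmoothProjective 2 K) (m : ℕ) :
    HodgeConjectureFor ((m + 1) * 2) (K.pow (m + 1)) :=
  Xu2018_hodgeClasses_algebraic_generalizedKummerVariety.hodgeConjectureFor_pow_kummerSurface hXu hA hK hKs m

/-- **An ANCHOR for `HC_KummerType` in every dimension**: a generalized Kummer variety `Kⁿ(A)` of an abelian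
surface, smooth projective of dimension `2n` and carrying a Hodge model, is itself of `Kumⁿ`-type
(`IsOfGeneralizedKummerType.of_hodgeModel`, Literature D1) AND satisfies the Hodge conjecture (Xu) — so for
`n ≥ 1` the deformation class of row 2b contains members at which `HodgeConjectureFor (2 * n)` holds.
[cite: Xu2018Kummer, Thm. 1.3] [cite: Beauville1983, §7 Théorème 4] -/
theorem isOfGeneralizedKummerType_and_hc (hXu : Xu2018_hodgeClasses_algebraic_generalizedKummerVariety)
    (hA : A.dim = 2) (hn : 1 ≤ n) (hK : IsGeneralizedKummerVarietyOf n A K) (hKs : IsSmoothProjective (2 * n) K)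
    (M : HodgeModel (2 * n) K) : IsOfGeneralizedKummerType n K ∧ HodgeConjectureFor (2 * n) K :=
  ⟨IsOfGeneralizedKummerType.of_hodgeModel hA hK hKs M, hc_generalizedKummerVariety hXu hA hn hK hKs⟩

/-- **UNCONDITIONAL printed chain for row 2a-type varieties built on Kummer surfaces**: for the Kummer surface
`K = Km(A)` of a complex abelian surface and a Hilbert scheme of `n` points `(H, Ξ)` of `K`, smooth projective
of dimension `2n`, the Hodge conjecture holds for `H = Km(A)^{[n]}` and all its powers — Xu 2018 Thm. 1.3
(all powers of `Km(A)`) fed into de Cataldo–Migliorini 2002 Thm. 6.2.1 + Arapura 2006 Lemma 4.2; three CITE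
records of printed theorems, no open hypothesis. [cite: Xu2018Kummer, Thm. 1.3] [cite: Arapura2006, Lemma 4.2]
[cite: DecataldoMigliorini2002, Thm. 6.2.1] -/
theorem hc_hilbertScheme_kummerSurface (hXu : Xu2018_hodgeClasses_algebraic_generalizedKummerVariety)
    (h42 : Arapura2006_hodgeClasses_algebraic_of_isDominatedByPowers)
    (h74 : DecataldoMigliorini2002_hilbertScheme_isDominatedByPowers) (hA : A.dim = 2)
    (hK : IsGeneralizedKummerVarietyOf 1 A K) (hKs : IsSmoothProjective 2 K) {H : SchemeOver ℂ}
    {Ξ : (K ⊗ H).left.IdealSheafData} (hH : IsHilbertSchemeOfPoints n K H Ξ) (hHs : IsSmoothProjective (2 * n) H) :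
    HodgeConjectureFor (2 * n) H ∧ ∀ m : ℕ, HodgeConjectureFor ((m + 1) * (2 * n)) (H.pow (m + 1)) :=
  Arapura2006_hodgeClasses_algebraic_of_isDominatedByPowers.hodgeConjectureFor_hilbertScheme_of_surfacePowers
    h42 h74 hKs hH hHs (hc_kummerSurface_pow hXu hA hK hKs)

end GeneralizedKummer

end Summit.HodgeConjecture.CorCM.Stage4

end
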